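import Summits.HubbardSuperconductivity.HubbardSuperconductivity.Theorems.ThermalWedgeTwTipContinuationWeakCouplingDarknessSlater
import Summits.HubbardSuperconductivity.HubbardSuperconductivity.Theorems.ThermalWedgeTwTipContinuationAnchorDischarge

/-!
# `TwTipContinuation` (stmt-HubbardSuperconductivity-1700) — weak-coupling darkness, piece 3b:
# a weak-coupling ground state has an almost sharp Fermi surface

For `L ≥ 3`, `U ≥ 0` and EVERY normalised ground state `ψ` of the pure repulsive torus
`hubbardTorus 2 L 1 U` in a sector `(2n, S^z = 0)` there is a Fermi level `μ` (of the free gas at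
`n` particles per spin) such that the momentum distribution `ρ_k = ⟨n_{k↑}⟩_ψ ∈ [0,1]` satisfies

  `Σ_k |ε_L(k) - μ| ρ_k (1 - ρ_k) ≤ U L²`      (`smearing_le_of_groundState`).

Proof (three elementary inequalities on literal route terms):
* kinetic energy in chemical-potential form with the smearing defect kept:
  `(ε - μ)ρ ≥ min(ε - μ, 0) + |ε - μ| ρ(1 - ρ)` for `ρ ∈ [0,1]`, summed over the `2L²` Bloch modes
  with `Σ_{kσ} ρ_{kσ} = 2n` (`re_expect_hubbardTorus_zero_ge_smear`, refining `freeSectorEnergy_ge`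
  of the line `isogap-submodular-transport`);
* the variational sandwich `re⟨ψ, H₀ ψ⟩ ≤ re⟨ψ, H_U ψ⟩ = E_U(2n) ≤ E₀(2n) + U L²`
  (`U Σ_x n_{x↑}n_{x↓} ≥ 0`, `AnchorDischarge.sectorEnergy_le_free_add`);
* the Slater bound `E₀(2n) ≤ 2 Σ_{k∈F} ε_L(k) = Σ_k 2min(ε_L(k) - μ, 0) + 2nμ` at a Fermi set `F`
  of the `n` lowest levels with Fermi level `μ` (`freeSectorEnergy_le_twice_sum`, `exists_fermiSet`).
So the interaction budget `U L²` is all a ground state can spend on smearing its Fermi surface —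
the quantitative form of "the weak-coupling ground state is a filled Fermi sea to zeroth order".
[folklore]
-/

noncomputable section

namespace Summit.HubbardSuperconductivity.TwTipContinuation.WeakCouplingDarkness

open Matrix Finset
open Literature.MathematicalPhysics.QuantumLattice Literature.Probability.LatticeModels
open Summit.HubbardSuperconductivity.TwTipContinuation.IsogapTransport
open Summit.HubbardSuperconductivity.TwTipContinuation.Negative
open Summit.HubbardSuperconductivity.TwTipContinuation.AnchorDischarge
open scoped ComplexOrder

variable {L : ℕ} [NeZero L]

/-! ### The smearing defect in the chemical-potential form of the kinetic energy -/

omit [NeZero L] in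
/-- `(ε - μ)ρ ≥ min(ε - μ, 0) + |ε - μ| ρ(1 - ρ)` (for all real `ρ`; used for occupations
`ρ ∈ [0,1]`): `aρ - aρ(1-ρ) = aρ² ≥ 0` for `a ≥ 0`, `aρ - a + aρ(1-ρ) = -a(1-ρ)² ≥ 0` for `a ≤ 0`. [folklore] -/
theorem min_add_abs_mul_smear_le (a ρ : ℝ) :
    min a 0 + |a| * (ρ * (1 - ρ)) ≤ a * ρ := by
  rcases le_total 0 a with ha | ha
  · rw [min_eq_right ha, abs_of_nonneg ha, zero_add]
    nlinarith [mul_nonneg ha (sq_nonneg ρ)]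
  · rw [min_eq_left ha, abs_of_nonpos ha]
    nlinarith [mul_nonneg (neg_nonneg.2 ha) (sq_nonneg (1 - ρ))]

/-- **Kinetic energy in chemical-potential form, with the smearing defect.** For `L ≥ 3`, any real
`μ` and any normalised `N`-particle vector `ψ`:
`Σ_k 2min(ε_L(k) - μ, 0) + μN + Σ_{kσ} |ε_L(k) - μ| ρ_{kσ}(1 - ρ_{kσ}) ≤ re⟨ψ, H₀ ψ⟩`,
`ρ_{kσ} = re⟨ψ, n_{kσ} ψ⟩` (only `Σ_{kσ} ρ_{kσ} = N` is used). [folklore] -/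
theorem re_expect_hubbardTorus_zero_ge_smear (hL : 3 ≤ L) (μ : ℝ) {N : ℕ}
    {ψ : Fock (Orb (FermionTorus 2 L))} (hψN : IsNParticle N ψ) (hψ1 : star ψ ⬝ᵥ ψ = 1) :
    ∑ k : TorusSite 2 L, 2 * min (torusBand L k - μ) 0 + μ * N +
        ∑ k : TorusSite 2 L, ∑ σ : Fin 2, |torusBand L k - μ| *
          ((expect (momentumNumber k σ) ψ).re * (1 - (expect (momentumNumber k σ) ψ).re)) ≤
      (expect (hubbardTorus 2 L 1 0) ψ).re := by
  have hdec : hubbardTorus 2 L 1 0 = hubbardTorusWith 2 L 1 0 μ + (μ : ℂ) • totalNumber := by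
    rw [hubbardTorusWith_eq, sub_add_cancel]
  have hN : expect totalNumber ψ = (N : ℂ) := by
    rw [hψN.expect_totalNumber, hψ1, mul_one]
  rw [hdec, expect_add, expect_smul, hN, hubbardTorusWith_zero_eq_sum_momentumNumber hL μ,
    expect_sum, Complex.add_re, Complex.re_sum]
  have hμN : ((μ : ℂ) * (N : ℂ)).re = μ * N := by
    rw [← Complex.ofReal_natCast, ← Complex.ofReal_mul, Complex.ofReal_re]
  rw [hμN, add_assoc, add_comm (μ * N), ← add_assoc, ← Finset.sum_add_distrib]
  gcongr with k
  rw [expect_sum, Complex.re_sum, Fin.sum_univ_two, Fin.sum_univ_two, expect_smul, expect_smul,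
    Complex.re_ofReal_mul, Complex.re_ofReal_mul, two_mul]
  have := min_add_abs_mul_smear_le (torusBand L k - μ) (expect (momentumNumber k 0) ψ).re
  have := min_add_abs_mul_smear_le (torusBand L k - μ) (expect (momentumNumber k 1) ψ).re
  linarith

/-! ### Fermi sets of the free band -/

/-- **A Fermi set exists at every filling**: for `n ≤ L²` there are `n` momenta `F` and a Fermi
level `μ` with `ε_L ≤ μ` on `F` and `ε_L ≥ μ` off `F` (minimise `Σ_F ε_L` over `n`-subsets and
exchange). [folklore] -/
theorem exists_fermiSet {n : ℕ} (hn : n ≤ Fintype.card (TorusSite 2 L)) :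
    ∃ F : Finset (TorusSite 2 L), F.card = n ∧ ∃ μ : ℝ,
      (∀ k ∈ F, torusBand L k ≤ μ) ∧ (∀ k ∉ F, μ ≤ torusBand L k) := by
  classical
  have hne : ((Finset.univ : Finset (TorusSite 2 L)).powersetCard n).Nonempty := by
    rw [Finset.powersetCard_nonempty, Finset.card_univ]
    exact hn
  obtain ⟨F, hF, hmin⟩ := Finset.exists_min_image _ (fun G : Finset (TorusSite 2 L) => ∑ k ∈ G, torusBand L k) hne
  rw [Finset.mem_powersetCard] at hF
  -- exchange: every level in `F` lies below every level outside `F`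
  have hex : ∀ k ∈ F, ∀ k' ∉ F, torusBand L k ≤ torusBand L k' := by
    intro k hk k' hk'
    set G := insert k' (F.erase k) with hG
    have hkG : k' ∉ F.erase k := fun h => hk' (Finset.mem_of_mem_erase h)
    have hGmem : G ∈ (Finset.univ : Finset (TorusSite 2 L)).powersetCard n := by
      rw [Finset.mem_powersetCard]
      refine ⟨Finset.subset_univ _, ?_⟩
      rw [hG, Finset.card_insert_of_notMem hkG, Finset.card_erase_of_mem hk, hF.2]
      have : 0 < n := by rw [← hF.2]; exact Finset.card_pos.2 ⟨k, hk⟩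
      omega
    have h := hmin G hGmem
    rw [hG, Finset.sum_insert hkG, ← Finset.add_sum_erase F _ hk] at h
    linarith
  refine ⟨F, hF.2, ?_⟩
  by_cases hc : (Finset.univ \ F).Nonempty
  · refine ⟨(Finset.univ \ F).inf' hc (torusBand L), fun k hk => ?_, fun k hk => ?_⟩
    · exact Finset.le_inf' hc _ fun k' hk' => hex k hk k' (Finset.mem_sdiff.1 hk').2
    · exact Finset.inf'_le _ (Finset.mem_sdiff.2 ⟨Finset.mem_univ _, hk⟩)
  · refine ⟨4, fun k _ => torusBand_le_four L k, fun k hk => ?_⟩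
    exact absurd ⟨k, Finset.mem_sdiff.2 ⟨Finset.mem_univ _, hk⟩⟩ hc

omit [NeZero L] in
/-- At a Fermi set: `2 Σ_{k∈F} ε_L(k) = Σ_k 2min(ε_L(k) - μ, 0) + 2|F|μ`. [folklore] -/
theorem twice_sum_eq_of_fermiSet [Fintype (TorusSite 2 L)] {F : Finset (TorusSite 2 L)} {μ : ℝ}
    (h1 : ∀ k ∈ F, torusBand L k ≤ μ) (h2 : ∀ k ∉ F, μ ≤ torusBand L k) :
    2 * ∑ k ∈ F, torusBand L k =
      ∑ k : TorusSite 2 L, 2 * min (torusBand L k - μ) 0 + μ * (2 * (F.card : ℝ)) := by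
  classical
  have hmin : ∀ k : TorusSite 2 L, min (torusBand L k - μ) 0 = if k ∈ F then torusBand L k - μ else 0 := by
    intro k
    split_ifs with hk
    · exact min_eq_left (by linarith [h1 k hk])
    · exact min_eq_right (by linarith [h2 k hk])
  simp only [hmin, mul_ite, mul_zero]
  rw [Finset.sum_ite_mem, Finset.univ_inter, Finset.mul_sum]
  rw [show ∑ k ∈ F, 2 * (torusBand L k - μ) = ∑ k ∈ F, 2 * torusBand L k - ∑ k ∈ F, 2 * μ by
    rw [← Finset.sum_sub_distrib]; exact Finset.sum_congr rfl fun k _ => by ring]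
  rw [Finset.sum_const, nsmul_eq_mul]
  ring

/-! ### The smearing bound -/

/-- **A weak-coupling ground state has an almost sharp Fermi surface.** For `L ≥ 3`, `U ≥ 0`
and every normalised ground state `ψ` of `hubbardTorus 2 L 1 U` in the sector `(2n, S^z = 0)`
there is a real `μ` with `Σ_k |ε_L(k) - μ| ρ_k(1 - ρ_k) ≤ U L²`, `ρ_k = re⟨ψ, n_{k↑} ψ⟩`. [folklore] -/
theorem smearing_le (hL : 3 ≤ L) {U : ℝ} (hU : 0 ≤ U) {n : ℕ}
    {ψ : Fock (Orb (FermionTorus 2 L))} (hψ1 : star ψ ⬝ᵥ ψ = 1)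
    (hgs : IsGroundStateInSector (hubbardTorus 2 L 1 U) (2 * n) 0 ψ) :
    ∃ μ : ℝ, ∑ k : TorusSite 2 L, |torusBand L k - μ| *
        ((expect (momentumNumber k 0) ψ).re * (1 - (expect (momentumNumber k 0) ψ).re)) ≤
      U * (L : ℝ) ^ 2 := by
  have hnF : n ≤ Fintype.card (FermionTorus 2 L) := le_card_of_mem_szSector L hgs.1 hgs.2.1
  have hnT : n ≤ Fintype.card (TorusSite 2 L) := by
    rwa [card_torusSite_two, ← Summit.HubbardSuperconductivity.NoGo.card_fermionTorus_two]
  obtain ⟨F, hFn, μ, hF1, hF2⟩ := exists_fermiSet hnT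
  refine ⟨μ, ?_⟩
  have hψN : IsNParticle (2 * n) ψ := ((mem_szSector_iff _ _ _).1 hgs.1).1
  -- (1) kinetic energy with the smearing defect
  have hkin := re_expect_hubbardTorus_zero_ge_smear hL μ hψN hψ1
  -- (2) `re⟨ψ, H₀ ψ⟩ ≤ re⟨ψ, H_U ψ⟩ = E_U(2n)`
  have hsplit := re_expect_seededH_eq_free_add U 0 L ψ
  rw [seededH_zero, seededH_zero] at hsplit
  have hD := re_expect_doubleOccupancy_nonneg ψ
  have hEU := expect_eq_of_groundState L hψ1 hgs
  -- (3) `E_U(2n) ≤ E₀(2n) + U L²`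
  have hcmp := sectorEnergy_le_free_add U 0 L hU hnF
  rw [seededH_zero, seededH_zero] at hcmp
  -- (4) Slater: `E₀(2n) ≤ 2Σ_F ε = Σ 2min + 2nμ`
  have hsl := freeSectorEnergy_le_twice_sum hL F
  rw [hFn, twice_sum_eq_of_fermiSet hF1 hF2, hFn] at hsl
  -- drop the spin-down smearing (nonnegative)
  have hdrop : ∑ k : TorusSite 2 L, |torusBand L k - μ| *
        ((expect (momentumNumber k 0) ψ).re * (1 - (expect (momentumNumber k 0) ψ).re)) ≤
      ∑ k : TorusSite 2 L, ∑ σ : Fin 2, |torusBand L k - μ| *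
        ((expect (momentumNumber k σ) ψ).re * (1 - (expect (momentumNumber k σ) ψ).re)) := by
    refine Finset.sum_le_sum fun k _ => ?_
    rw [Fin.sum_univ_two]
    have h0 := re_expect_momentumNumber_nonneg k 1 ψ
    have h1 : (expect (momentumNumber k 1) ψ).re ≤ 1 := by
      have := re_expect_momentumNumber_le k 1 ψ
      rwa [hψ1, Complex.one_re] at this
    have : 0 ≤ |torusBand L k - μ| * ((expect (momentumNumber k 1) ψ).re * (1 - (expect (momentumNumber k 1) ψ).re)) :=
      mul_nonneg (abs_nonneg _) (mul_nonneg h0 (by linarith [h1]))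
    linarith
  have hEUre : (expect (hubbardTorus 2 L 1 U) ψ).re =
      Matrix.minEnergyOn (hubbardTorus 2 L 1 U) (szSector (2 * n) 0) := by
    rw [hEU, Complex.ofReal_re]
  have hcast : (μ * ((2 * n : ℕ) : ℝ) : ℝ) = μ * (2 * (n : ℝ)) := by push_cast; ring
  rw [hcast] at hkin
  nlinarith [mul_nonneg hU hD]

/-- **A weak-coupling ground state has an almost sharp Fermi surface (piece 3b of the
weak-coupling darkness bound for `TwTipContinuation`)**, closed form. [folklore] -/
theorem smearing_le_of_groundState :
    ∀ (L : ℕ) [NeZero L], 3 ≤ L → ∀ (U : ℝ), 0 ≤ U → ∀ (n : ℕ) (ψ : Fock (Orb (FermionTorus 2 L))), star ψ ⬝ᵥ ψ = 1 → IsGroundStateInSector (hubbardTorus 2 L 1 U) (2 * n) 0 ψ → ∃ μ : ℝ, ∑ k : TorusSite 2 L, |torusBand L k - μ| * ((expect (momentumNumber k 0) ψ).re * (1 - (expect (momentumNumber k 0) ψ).re)) ≤ U * (L : ℝ) ^ 2 :=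
  fun _ _ hL _ hU _ _ hψ1 hgs => smearing_le hL hU hψ1 hgs

end Summit.HubbardSuperconductivity.TwTipContinuation.WeakCouplingDarkness
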